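import Summits.ResolutionOfSingularities.ResolutionOfSingularities.Theorems.HilbertSamuelEliminationSigmaMaxModificationsCorridor3WLadderIsoTailsSeparableBaseChangeLocal
import Summits.ResolutionOfSingularities.ResolutionOfSingularities.Theorems.HilbertSamuelEliminationSigmaMaxModificationsCorridor3WLadderAlgIsolatedTransfer
import HarnessLib

/-!
# [OURS · L1 W4.2] K2-sep ROUTE A, brick (β) ring core, part 2: **dimension and the EASY HALF of `ψ` along a separable ground-field extension**
# — `dim (A ⊗ₖ K)_𝔓 = dim A_𝔭` and `ψ[(A ⊗ₖ K)_𝔓] ≤ ψ[A_𝔭]` (res-D-pv-042's flat-local `ψ`-descent `le_minimalPrimesCodim_of_flat` /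
# Matsumura 15.1, fed by part 1's `𝔭 (A ⊗ₖ K)_𝔓 = 𝔪` and flatness)
# (crux `SigmaMaxModifications` stmt-ResolutionOfSingularities-18506 / conjunct stmt-…-19249; line `w_ladder_rows` v8.5, registered stub
# `stub_isoSepRecurrent`; res-L1-w42-plan-1 WORD 2026-08-27T16:25:47Z; design `L/res-L1-w42-stub-2/k2sep/K2SEP-DESIGN.md` §6 (β2)/(β5))

Prover res-L1-w42-stub-2 (gen 5). Helper file `--supports stmt-ResolutionOfSingularities-19249 --as helper`; no definitions, no named fact. OURS
(cell res-hironaka, slot W4.2); NOT statements of [Hironaka2017] nor of [CossartJannsenSaito2020]. AI-written; AI review is weaker than expert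
review. The REVERSE inequality `ψ[A_𝔭] ≤ ψ[(A ⊗ₖ K)_𝔓]` (equidimensionality of the base change of the local domains `A_𝔭/q`) is the open
brick (β2) of the memo and is NOT claimed here.

* `ringKrullDim_localization_tensorProduct_eq` — `dim (A ⊗ₖ K)_𝔓 = dim A_𝔭` (`K/k` separable algebraic, `A`, `A ⊗ₖ K` Noetherian).
* `minimalPrimesCodim_localization_tensorProduct_le` — `ψ[(A ⊗ₖ K)_𝔓] ≤ ψ[A_𝔭]`.

[OURS · L1 W4.2; AI-written] [cite: CossartJannsenSaito2020, Def. 2.28 (2), Lemma 2.37 (2)] [cite: Matsumura1987, Thm. 15.1]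
-/

set_option linter.dupNamespace false

noncomputable section

open scoped TensorProduct
open IsLocalRing Literature.RingTheory.HilbertSamuel Literature.AlgebraicGeometry.Resolution
open Summit.ResolutionOfSingularities.ResolutionOfSingularities.Cruxes.SigmaMaxModifications.IdeasL1C4

namespace Summit.ResolutionOfSingularities.ResolutionOfSingularities.Theorems.SigmaMaxModificationsCorridor3.IsoTailsHS

universe u

variable {k K A : Type u} [Field k] [Field K] [Algebra k K] [Algebra.IsSeparable k K] [CommRing A] [Algebra k A]
  [IsNoetherianRing A] [IsNoetherianRing (A ⊗[k] K)]

/-- **`dim (A ⊗ₖ K)_𝔓 = dim A_𝔭`** for `K/k` separable algebraic and `𝔓` over `𝔭` (flat local with `𝔭 (A ⊗ K)_𝔓 = 𝔪`: Matsumura 15.1, via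
res-D-pv-042's `ringKrullDim_quotient_map_eq_of_flat` at `q = 0`). [cite: Matsumura1987, Thm. 15.1] -/
theorem ringKrullDim_localization_tensorProduct_eq (𝔓 : Ideal (A ⊗[k] K)) [𝔓.IsPrime] :
    ringKrullDim (Localization.AtPrime 𝔓) = ringKrullDim (Localization.AtPrime (𝔓.under A)) := by
  letI := Localization.AtPrime.algebraOfLiesOver (𝔓.under A) 𝔓
  haveI := flat_localization_tensorProduct (k := k) (A := A) 𝔓
  have hm : (maximalIdeal (Localization.AtPrime (𝔓.under A))).map
      (algebraMap (Localization.AtPrime (𝔓.under A)) (Localization.AtPrime 𝔓)) = maximalIdeal (Localization.AtPrime 𝔓) := by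
    rw [← Localization.AtPrime.map_eq_maximalIdeal, Ideal.map_map,
      ← IsScalarTower.algebraMap_eq A (Localization.AtPrime (𝔓.under A)) (Localization.AtPrime 𝔓)]
    exact map_under_eq_maximalIdeal 𝔓
  haveI : IsLocalHom (algebraMap (Localization.AtPrime (𝔓.under A)) (Localization.AtPrime 𝔓)) :=
    isLocalHom_of_map_maximalIdeal_eq hm
  have h := ringKrullDim_quotient_map_eq_of_flat hm (⊥ : Ideal (Localization.AtPrime (𝔓.under A))) bot_ne_top
  have e1 : ringKrullDim (Localization.AtPrime 𝔓 ⧸ (⊥ : Ideal (Localization.AtPrime (𝔓.under A))).map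
      (algebraMap (Localization.AtPrime (𝔓.under A)) (Localization.AtPrime 𝔓))) = ringKrullDim (Localization.AtPrime 𝔓) := by
    rw [Ideal.map_bot]
    exact ringKrullDim_eq_of_ringEquiv (RingEquiv.quotientBot (Localization.AtPrime 𝔓))
  have e2 : ringKrullDim (Localization.AtPrime (𝔓.under A) ⧸ (⊥ : Ideal (Localization.AtPrime (𝔓.under A)))) =
      ringKrullDim (Localization.AtPrime (𝔓.under A)) :=
    ringKrullDim_eq_of_ringEquiv (RingEquiv.quotientBot (Localization.AtPrime (𝔓.under A)))
  rw [e1, e2] at h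
  exact h

/-- **`ψ[(A ⊗ₖ K)_𝔓] ≤ ψ[A_𝔭]`** (the easy half of the `ψ`-transfer: res-D-pv-042's `le_minimalPrimesCodim_of_flat` along the flat local
`A_𝔭 → (A ⊗ₖ K)_𝔓` with `𝔭 (A ⊗ K)_𝔓 = 𝔪`). [cite: CossartJannsenSaito2020, Def. 2.28 (2), Lemma 2.37 (2)] -/
theorem minimalPrimesCodim_localization_tensorProduct_le (𝔓 : Ideal (A ⊗[k] K)) [𝔓.IsPrime] :
    minimalPrimesCodim (Localization.AtPrime 𝔓) ≤ minimalPrimesCodim (Localization.AtPrime (𝔓.under A)) := by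
  letI := Localization.AtPrime.algebraOfLiesOver (𝔓.under A) 𝔓
  haveI := flat_localization_tensorProduct (k := k) (A := A) 𝔓
  have hm : (maximalIdeal (Localization.AtPrime (𝔓.under A))).map
      (algebraMap (Localization.AtPrime (𝔓.under A)) (Localization.AtPrime 𝔓)) = maximalIdeal (Localization.AtPrime 𝔓) := by
    rw [← Localization.AtPrime.map_eq_maximalIdeal, Ideal.map_map,
      ← IsScalarTower.algebraMap_eq A (Localization.AtPrime (𝔓.under A)) (Localization.AtPrime 𝔓)]
    exact map_under_eq_maximalIdeal 𝔓
  haveI : IsLocalHom (algebraMap (Localization.AtPrime (𝔓.under A)) (Localization.AtPrime 𝔓)) :=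
    isLocalHom_of_map_maximalIdeal_eq hm
  refine le_minimalPrimesCodim_of_flat hm fun 𝔓' h𝔓' => ?_
  haveI := h𝔓'.1.1
  obtain ⟨n, hn⟩ := exists_ringKrullDim_quotient_eq_nat (Localization.AtPrime 𝔓) 𝔓'
  rw [hn]
  exact_mod_cast minimalPrimesCodim_le (Localization.AtPrime 𝔓) h𝔓' hn

end Summit.ResolutionOfSingularities.ResolutionOfSingularities.Theorems.SigmaMaxModificationsCorridor3.IsoTailsHS

end
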